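import Summits.QuantumFields.BalabanUV.Beta.GAN24.LatticeKernelConvolutionTwo
import Summits.QuantumFields.BalabanUV.Beta.GAN24.LatticeKernelReality

/-!
# `BalabanUV.Beta.GAN24.LatticeKernelSwap` — binder row G-an2-4 / (CONV-C), STENCIL slot, campaign «E3Shape» (`SKELETON-S3.md` node S3-L1, ANALYSIS HALF,
# part 4): the BLOCK SWAP `K₂[V](x, y) = K₂[Vᵀ](y, x)` of leaf-14's two-momentum kernel (Fubini in the other order), reflection invariance of strip
# regularity, and the RIGHT-HAND mixed product theorem `Σ'_w K₂[V](x, w) · K[C](w − y) = K₂[(p,q) ↦ V(p,q) C(−q)](x, y)`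

NOT IN PRINT; OUR BOOKKEEPING (engine «LK-CONV*» part 4, CLAIMS l.4153 ∕ l.4206 ∕ l.4361; row owner gan24-p1-g3 RULINGS-2 l.4221; unit
b2b-balaban-gan24-formalise-leaf-07, gen 9).  HONEST FRAMING (cell contract, verbatim): «discharging `BetaPertH` makes Bałaban's UV stability UNCONDITIONAL —
a real constructive-QFT result; it is NOT the continuum limit and NOT the Clay problem.»  HONEST DEPENDENCY (verbatim): «continuum YM on T⁴ ⇐ BetaPertH ∧
nine spine estimates (0/9 proved); BetaPertH ⇐ (D1) ∧ (D4) ∧ CAP+tail; G-an2-4 gates asym, D1 and NE2/3/4.»  [folklore] Fourier analysis on `ℤ^{d+1}`: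
cites nothing, mints no `def … : Prop`, asserts no statement of Bałaban's, instantiates no wall binder.  NOT summit progress.

## Why (context only; asserted nowhere below)

The sandwich of S3-L1 has an outer factor on EACH side: `Σ'_{w,w′} K[A](x − w) · K₂[V](w, w′) · K[C](w′ − y)`.  Part 2b
(`LatticeKernelConvolutionTwo.tsum_latticeKernel_mul_latticeKernel₂`) absorbs the left factor; the right factor is absorbed by the same theorem after
SWAPPING the two momentum blocks — `latticeKernel₂ V x y = latticeKernel₂ (fun q p => V p q) y x`, i.e. Fubini in the other order — and reflecting the
one-momentum symbol (`K[C](w − y) = K[C(−·)](y − w)`, `LatticeKernelReality.latticeKernel_reflect`).  With leaf-14's sign convention `e^{i(p·x + q·y)}`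
the absorbed right factor appears as `C(−q)`.

## Contents (all [folklore])
§1 `joint_swap : joint Vᵀ = joint V ∘ (P ↦ pair (sndC P) (fstC P))`, **`stripRegular_joint_swap : StripRegular (joint V) κ M → StripRegular (joint fun q p => V p q) κ M`**
   (the block swap `inl2 ↔ inr2` is an injective re-indexing; leaf-14's `stripRegular_comp_restrict`; no new definition).
§2 **`latticeKernel₂_swap : latticeKernel₂ V x y = latticeKernel₂ (fun q p => V p q) y x`** (leaf-14's Fubini twice + `MeasureTheory.integral_integral_swap`;
   the integrand is continuous on the compact real zone square).
§3 `neg_mem_Strip_iff`, `neg_update_ofRealVec`, **`stripRegular_comp_neg : StripRegular G κ M → StripRegular (fun p => G (-p)) κ M`**.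
§4 **`tsum_latticeKernel₂_mul_latticeKernel : Σ'_w latticeKernel₂ V x w * latticeKernel C (w − y) = latticeKernel₂ (fun p q => V p q * C (-q)) x y`**
   (+ summability).
§5 **`tsum_tsum_sandwich : Σ'_w K[A](x − w) · Σ'_{w′} K₂[V](w, w′) · K[C](w′ − y) = K₂[(p,q) ↦ A(p)·(V(p,q)·C(−q))](x, y)`** — S3-L1's composed kernel as
   ONE two-momentum kernel of the product symbol (translation-invariant outer legs; the block-structured legs of an2's `KInv` are finite sums of these).
NOT BetaPertH, NOT continuum, NOT Clay.
-/

noncomputable section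

open Complex Set MeasureTheory Filter Topology Function
open Literature.MathematicalPhysics.QuantumFieldTheory.Balaban1983to89
open B4Strip (ofRealVec Strip)
open B4ContourShift (BZ latticeKernel StripRegular supNorm ofRealVec_mem_Strip openRect integrand phase)
open Summit.QuantumFields.BalabanUV.Beta.GAN24.LatticeKernelConvolution (stripRegular_nonneg)
open Summit.QuantumFields.BalabanUV.Beta.GAN24.LatticeKernelReality (neg_mem_BZ_iff ofRealVec_neg latticeKernel_reflect)
open Summit.QuantumFields.BalabanUV.Beta.GAN24.LatticeKernelConvolutionTwo (diff_update sides_update stripRegular_of_update pair_mem_Strip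
  tsum_latticeKernel_mul_latticeKernel₂ summable_latticeKernel_mul_latticeKernel₂)
open Summit.QuantumFields.BalabanUV.Beta.GAN24.StripRegularRestrict (restrict inl2 inr2 pair pair_inl pair_inr inl2_or_inr2 fstC sndC fstC_apply
  sndC_apply fstC_pair sndC_pair joint joint_apply joint_pair ofRealVec_pair stripRegular_comp_restrict stripRegular_compSnd)
open Summit.QuantumFields.BalabanUV.Beta.GAN24.StripRegularBiLoc (latticeKernel₂ latticeKernel₂_eq_iterated pair_mem_BZ_iff)
open scoped Real

namespace Summit.QuantumFields.BalabanUV.Beta.GAN24.LatticeKernelSwap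

variable {d : ℕ}

/-! ## §1 The block swap of the joint symbol -/

section Swap

/-- [folklore] the joint symbol of the TRANSPOSED two-momentum symbol is the joint symbol at the block-swapped joint momentum. -/
theorem joint_swap (V : (Fin (d + 1) → ℂ) → (Fin (d + 1) → ℂ) → ℂ) :
    joint (fun q p => V p q) = fun P => joint V (pair (sndC P) (fstC P)) := by
  funext P
  rw [joint_apply, joint_pair]

/-- [folklore] **JOINT STRIP REGULARITY IS SWAP INVARIANT** (the block swap is an injective re-indexing; leaf-14's `stripRegular_comp_restrict`). -/
theorem stripRegular_joint_swap {V : (Fin (d + 1) → ℂ) → (Fin (d + 1) → ℂ) → ℂ} {κ M : ℝ} (h : StripRegular (joint V) κ M) :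
    StripRegular (joint fun q p => V p q) κ M := by
  -- the block-swap re-indexing `σ (inl2 i) = inr2 i`, `σ (inr2 i) = inl2 i`
  let σ : Fin (d + 1 + d + 1) → Fin (d + 1 + d + 1) :=
    fun l => @Fin.addCases (d + 1) (d + 1) (fun _ => Fin (d + 1 + d + 1)) (fun i => inr2 i) (fun i => inl2 i) l
  have hl : ∀ i, σ (inl2 i) = inr2 i := fun i =>
    @Fin.addCases_left (d + 1) (d + 1) (fun _ => Fin (d + 1 + d + 1)) (fun i => inr2 i) (fun i => inl2 i) i
  have hr : ∀ i, σ (inr2 i) = inl2 i := fun i =>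
    @Fin.addCases_right (d + 1) (d + 1) (fun _ => Fin (d + 1 + d + 1)) (fun i => inr2 i) (fun i => inl2 i) i
  have hσσ : ∀ l, σ (σ l) = l := by
    intro l
    rcases inl2_or_inr2 l with ⟨i, rfl⟩ | ⟨i, rfl⟩
    · rw [hl, hr]
    · rw [hr, hl]
  have hσ : Function.Injective σ := Function.Involutive.injective hσσ
  have e : joint (fun q p => V p q) = fun P => joint V (restrict σ P) := by
    rw [joint_swap]
    funext P
    congr 1
    funext l
    rcases inl2_or_inr2 l with ⟨i, rfl⟩ | ⟨i, rfl⟩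
    · show pair (sndC P) (fstC P) (inl2 i) = P (σ (inl2 i))
      rw [pair_inl, sndC_apply, hl]
    · show pair (sndC P) (fstC P) (inr2 i) = P (σ (inr2 i))
      rw [pair_inr, fstC_apply, hr]
  rw [e]
  exact stripRegular_comp_restrict h hσ

end Swap

/-! ## §2 The block swap of the two-momentum kernel -/

section KernelSwap

variable {V : (Fin (d + 1) → ℂ) → (Fin (d + 1) → ℂ) → ℂ} {κ M : ℝ}

/-- [folklore] `(p, q) ↦ pair p q` is continuous. -/
theorem continuous_pair_prod : Continuous fun z : (Fin (d + 1) → ℝ) × (Fin (d + 1) → ℝ) => pair z.1 z.2 := by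
  refine continuous_pi fun l => ?_
  rcases inl2_or_inr2 l with ⟨i, rfl⟩ | ⟨i, rfl⟩
  · simp only [pair_inl]; exact (continuous_apply i).comp continuous_fst
  · simp only [pair_inr]; exact (continuous_apply i).comp continuous_snd

/-- [folklore] a jointly strip-regular symbol is jointly continuous on the real zone square. -/
theorem continuousOn_real_square (h : StripRegular (joint V) κ M) (hκ : 0 ≤ κ) :
    ContinuousOn (fun z : (Fin (d + 1) → ℝ) × (Fin (d + 1) → ℝ) => V (ofRealVec z.1) (ofRealVec z.2)) (BZ (d + 1) ×ˢ BZ (d + 1)) := by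
  have e : (fun z : (Fin (d + 1) → ℝ) × (Fin (d + 1) → ℝ) => V (ofRealVec z.1) (ofRealVec z.2)) =
      joint V ∘ fun z => ofRealVec (pair z.1 z.2) := by
    funext z; rw [Function.comp_apply, ofRealVec_pair, joint_pair]
  rw [e]
  refine h.cont.comp (B4ContourShift.continuous_ofRealVec.comp continuous_pair_prod).continuousOn fun z hz => ?_
  exact ofRealVec_mem_Strip hκ ((pair_mem_BZ_iff z.1 z.2).mpr ⟨(Set.mem_prod.mp hz).1, (Set.mem_prod.mp hz).2⟩)

/-- [folklore] **THE BLOCK SWAP**: `latticeKernel₂ V x y = latticeKernel₂ (fun q p => V p q) y x` — the two iterated zone integrals agree by Fubini on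
the compact zone square (the integrand is continuous there). -/
theorem latticeKernel₂_swap (h : StripRegular (joint V) κ M) (hκ : 0 ≤ κ) (x y : Fin (d + 1) → ℤ) :
    latticeKernel₂ V x y = latticeKernel₂ (fun q p => V p q) y x := by
  have hT := stripRegular_joint_swap h
  rw [latticeKernel₂_eq_iterated h hκ x y, latticeKernel₂_eq_iterated hT hκ y x]
  have hBZ : MeasurableSet (BZ (d + 1)) := by unfold BZ; exact measurableSet_Icc
  -- the common integrand
  set f : (Fin (d + 1) → ℝ) → (Fin (d + 1) → ℝ) → ℂ :=
    fun p q => V (ofRealVec p) (ofRealVec q) * cexp (I * phase q y) * cexp (I * phase p x) with hf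
  set c : ℝ := ((2 * π) ^ (d + 1))⁻¹ with hc
  have eL : ∀ p : Fin (d + 1) → ℝ, integrand (fun P => latticeKernel (V P) y) x p = c • ∫ q in BZ (d + 1), f p q := by
    intro p
    unfold integrand latticeKernel B4ContourShift.fourierBox
    rw [smul_mul_assoc, ← integral_mul_const]
    rfl
  have eR : ∀ q : Fin (d + 1) → ℝ, integrand (fun Q => latticeKernel (fun p => V p Q) x) y q = c • ∫ p in BZ (d + 1), f p q := by
    intro q
    unfold integrand latticeKernel B4ContourShift.fourierBox
    rw [smul_mul_assoc, ← integral_mul_const]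
    congr 1
    refine setIntegral_congr_fun hBZ fun p _ => ?_
    simp only [hf, integrand]
    ring
  -- integrability on the square
  have hint : Integrable (uncurry f) ((volume.restrict (BZ (d + 1))).prod (volume.restrict (BZ (d + 1)))) := by
    rw [Measure.prod_restrict, ← Measure.volume_eq_prod]
    have hcont : ContinuousOn (uncurry f) (BZ (d + 1) ×ˢ BZ (d + 1)) := by
      have e : uncurry f = fun z : (Fin (d + 1) → ℝ) × (Fin (d + 1) → ℝ) =>
          V (ofRealVec z.1) (ofRealVec z.2) * cexp (I * phase z.2 y) * cexp (I * phase z.1 x) := by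
        funext z; rfl
      rw [e]
      refine ((continuousOn_real_square h hκ).mul (Continuous.continuousOn ?_)).mul (Continuous.continuousOn ?_)
      · unfold B4ContourShift.phase; fun_prop
      · unfold B4ContourShift.phase; fun_prop
    have hK : IsCompact (BZ (d + 1) ×ˢ BZ (d + 1)) := by unfold BZ; exact isCompact_Icc.prod isCompact_Icc
    exact hcont.integrableOn_compact hK
  change c • ∫ p in BZ (d + 1), integrand (fun P => latticeKernel (V P) y) x p =
    c • ∫ q in BZ (d + 1), integrand (fun Q => latticeKernel (fun p => V p Q) x) y q
  rw [setIntegral_congr_fun hBZ fun p _ => eL p, setIntegral_congr_fun hBZ fun q _ => eR q, integral_smul, integral_smul,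
    integral_integral_swap hint]

end KernelSwap

/-! ## §3 Reflection invariance of strip regularity -/

section Reflect

/-- [folklore] the strip is symmetric under `p ↦ −p`. -/
theorem neg_mem_Strip_iff {D : ℕ} {κ : ℝ} (p : Fin D → ℂ) : -p ∈ Strip D κ ↔ p ∈ Strip D κ := by
  simp only [Strip, Set.mem_setOf_eq, Pi.neg_apply, Complex.neg_re, Complex.neg_im, abs_neg]

/-- [folklore] negating an updated real point. -/
theorem neg_update_ofRealVec {D : ℕ} (Q : Fin (D + 1) → ℝ) (i : Fin (D + 1)) (z : ℂ) :
    -(Function.update (ofRealVec Q) i z) = Function.update (ofRealVec (-Q)) i (-z) := by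
  funext j
  by_cases hj : j = i
  · subst hj; simp only [Pi.neg_apply, Function.update_self]
  · simp only [Pi.neg_apply, Function.update_of_ne hj, ofRealVec_neg]

/-- [folklore] the open rectangle is symmetric under `z ↦ −z`. -/
theorem neg_mem_openRect {κ : ℝ} {z : ℂ} (hz : z ∈ openRect κ) : -z ∈ openRect κ := by
  unfold openRect at hz ⊢
  rw [Complex.mem_reProdIm] at hz ⊢
  simp only [Complex.neg_re, Complex.neg_im, Set.mem_Ioo] at hz ⊢
  exact ⟨⟨by linarith [hz.1.2], by linarith [hz.1.1]⟩, ⟨by linarith [hz.2.2], by linarith [hz.2.1]⟩⟩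

/-- [folklore] **STRIP REGULARITY IS REFLECTION INVARIANT**: `G(−·)` is strip regular with the same `κ, M`. -/
theorem stripRegular_comp_neg {D : ℕ} {G : (Fin (D + 1) → ℂ) → ℂ} {κ M : ℝ} (h : StripRegular G κ M) :
    StripRegular (fun p => G (-p)) κ M := by
  refine stripRegular_of_update ?_ ?_ ?_ ?_
  · exact h.cont.comp continuous_neg.continuousOn fun p hp => (neg_mem_Strip_iff p).mpr hp
  · intro i Q hQ
    have hQ' : -Q ∈ BZ (D + 1) := (neg_mem_BZ_iff Q).mpr hQ
    have e : (fun z => G (-(Function.update (ofRealVec Q) i z))) = (fun w => G (Function.update (ofRealVec (-Q)) i w)) ∘ fun z => -z := by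
      funext z; rw [Function.comp_apply, neg_update_ofRealVec]
    rw [e]
    exact (diff_update h i hQ').comp (differentiableOn_neg _) fun z hz => neg_mem_openRect hz
  · intro i Q hQ y hy
    have hQ' : -Q ∈ BZ (D + 1) := (neg_mem_BZ_iff Q).mpr hQ
    have hy' : |(-y)| ≤ κ := by rwa [abs_neg]
    show G (-(Function.update (ofRealVec Q) i (-Real.pi + y * I))) = G (-(Function.update (ofRealVec Q) i (Real.pi + y * I)))
    rw [neg_update_ofRealVec, neg_update_ofRealVec,
      show (-(-(Real.pi : ℂ) + y * I) : ℂ) = Real.pi + ((-y : ℝ) : ℂ) * I by push_cast; ring,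
      show (-((Real.pi : ℂ) + y * I) : ℂ) = -Real.pi + ((-y : ℝ) : ℂ) * I by push_cast; ring]
    exact (sides_update h i hQ' hy').symm
  · intro p hp
    exact h.bound (-p) ((neg_mem_Strip_iff p).mpr hp)

end Reflect

/-! ## §4 The right-hand mixed product theorem -/

section Mixed

variable {V : (Fin (d + 1) → ℂ) → (Fin (d + 1) → ℂ) → ℂ} {C : (Fin (d + 1) → ℂ) → ℂ} {κ MV MC : ℝ}

/-- [folklore] the product symbol `V(p,q)·C(−q)` is jointly strip regular. -/
theorem stripRegular_joint_mul_right (hV : StripRegular (joint V) κ MV) (hC : StripRegular C κ MC) (hκ : 0 ≤ κ) :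
    StripRegular (joint fun p q => V p q * C (-q)) κ (MV * MC) :=
  hV.mul (stripRegular_compSnd (stripRegular_comp_neg hC)) (stripRegular_nonneg hV hκ)

/-- [folklore] **THE RIGHT-HAND MIXED PRODUCT THEOREM**: `Σ'_{w ∈ ℤ^{d+1}} K₂[V](x, w) · K[C](w − y) = K₂[(p,q) ↦ V(p,q) C(−q)](x, y)` (joint strip
regularity of `V`, strip regularity of `C`, `κ > 0`) — the right outer leg of S3-L1's sandwich. -/
theorem tsum_latticeKernel₂_mul_latticeKernel (hV : StripRegular (joint V) κ MV) (hC : StripRegular C κ MC) (hκ : 0 < κ)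
    (x y : Fin (d + 1) → ℤ) :
    ∑' w, latticeKernel₂ V x w * latticeKernel C (w - y) = latticeKernel₂ (fun p q => V p q * C (-q)) x y := by
  have hVt := stripRegular_joint_swap hV
  have hCn : StripRegular (fun p => C (-p)) κ MC := stripRegular_comp_neg hC
  have e1 : ∀ w, latticeKernel₂ V x w * latticeKernel C (w - y) =
      latticeKernel (fun p => C (-p)) (y - w) * latticeKernel₂ (fun q p => V p q) w x := by
    intro w
    rw [latticeKernel₂_swap hV hκ.le x w, latticeKernel_reflect C (y - w), neg_sub, mul_comm]
  simp_rw [e1]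
  rw [tsum_latticeKernel_mul_latticeKernel₂ hCn hVt hκ y x,
    latticeKernel₂_swap (stripRegular_joint_mul_right hV hC hκ.le) hκ.le x y]
  congr 1
  funext q p
  ring

/-- [folklore] summability of the right-hand mixed summand. -/
theorem summable_latticeKernel₂_mul_latticeKernel (hV : StripRegular (joint V) κ MV) (hC : StripRegular C κ MC) (hκ : 0 < κ)
    (x y : Fin (d + 1) → ℤ) :
    Summable fun w => latticeKernel₂ V x w * latticeKernel C (w - y) := by
  have hVt := stripRegular_joint_swap hV
  have hCn : StripRegular (fun p => C (-p)) κ MC := stripRegular_comp_neg hC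
  have e1 : ∀ w, latticeKernel₂ V x w * latticeKernel C (w - y) =
      latticeKernel (fun p => C (-p)) (y - w) * latticeKernel₂ (fun q p => V p q) w x := by
    intro w
    rw [latticeKernel₂_swap hV hκ.le x w, latticeKernel_reflect C (y - w), neg_sub, mul_comm]
  simp_rw [e1]
  exact summable_latticeKernel_mul_latticeKernel₂ hCn hVt hκ y x

end Mixed


/-! ## §5 The sandwich -/

section Sandwich

variable {A C : (Fin (d + 1) → ℂ) → ℂ} {V : (Fin (d + 1) → ℂ) → (Fin (d + 1) → ℂ) → ℂ} {κ MA MV MC : ℝ}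

/-- [folklore] **THE SANDWICH** (S3-L1's shape `K_N ∘ V ∘ K_N` for translation-invariant outer legs): for strip-regular one-momentum symbols `A, C` and a
jointly strip-regular two-momentum symbol `V` (one half-width `κ > 0`),
`Σ'_w K[A](x − w) · Σ'_{w′} K₂[V](w, w′) · K[C](w′ − y) = K₂[(p,q) ↦ A(p) · (V(p,q) · C(−q))](x, y)` — the iterated intermediate-site sums of the
composed kernel are the two-momentum kernel of the PRODUCT symbol. -/
theorem tsum_tsum_sandwich (hA : StripRegular A κ MA) (hV : StripRegular (joint V) κ MV) (hC : StripRegular C κ MC) (hκ : 0 < κ)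
    (x y : Fin (d + 1) → ℤ) :
    ∑' w, latticeKernel A (x - w) * ∑' w', latticeKernel₂ V w w' * latticeKernel C (w' - y) =
      latticeKernel₂ (fun p q => A p * (V p q * C (-q))) x y := by
  have e : ∀ w, ∑' w', latticeKernel₂ V w w' * latticeKernel C (w' - y) = latticeKernel₂ (fun p q => V p q * C (-q)) w y :=
    fun w => tsum_latticeKernel₂_mul_latticeKernel hV hC hκ w y
  simp_rw [e]
  exact tsum_latticeKernel_mul_latticeKernel₂ hA (stripRegular_joint_mul_right hV hC hκ.le) hκ x y

end Sandwich

end Summit.QuantumFields.BalabanUV.Beta.GAN24.LatticeKernelSwap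

end
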